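import Summits.Ventures.PercRepro.CoreSixPlanes

/-!
# PercRepro — the planes with `≥ 6` points at nullity `7` on `16` points of rank `9` (p2, gen 12)

On the coloop-free core with `|E| = 16`, `r(E) = 9` (nullity `7`): any two distinct planes `P₁ ≠ P₂` with `≥ 6`
points have a union `W` of nullity `≥ 5` whose closure `F = cl W` has nullity `≤ 6` (nullity `7` would make `F = E`, of
rank `≤ 6`), hence `≤ 12` points; every further plane `R` with `≥ 6` points meets `W` in `≥ 4` points (a trace of `≤ 3`
points would give `ν(W ∪ R) ≥ 7`, i.e. `W ∪ R = E` with `r(E) ≤ 8`) and therefore lies in `F`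
(`big_planes_subset_closure_seven`). The `4`-circuits inside `F` number at most `126` (the cocircuit count on `M|F`:
`≤ 12` elements, nullity `≤ 6`; `ncard_circuits_four_subset_le`), so, with the circuit-per-plane weights of
`CorePlanes`, `7·#{sets of rank ≤ 3 with ≥ 5 points} ≤ 7·s₄ + 22·126` (`seven_mul_ncard_big_sets_le_seven`).

* `ncard_circuits_four_subset_le` — `≤ 126` four-circuits inside a set of `≤ 12` points and nullity `≤ 6`;
* `big_planes_subset_closure_seven` — the planes with `≥ 6` points lie in `cl(P₁ ∪ P₂)`, `|cl(P₁ ∪ P₂)| ≤ 12`;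
* **`seven_mul_ncard_big_sets_le_seven`** — `7·A ≤ 7·s₄ + 2772`.
Imports `CoreSixPlanes`. Axioms: standard.
-/

namespace PercRepro
namespace CoreFour

open Set Finset

variable {α : Type} {M : Matroid α}

/-- **At most `126` four-circuits inside a set of `≤ 12` points and nullity `≤ 6`** (the cocircuit count on the
restriction, maximum at `9` series classes). -/
theorem ncard_circuits_four_subset_le [M.Finite] {S : Set α} (hS : S ⊆ M.E) (hS12 : S.ncard ≤ 12)
    (hν : S.encard ≤ M.eRk S + 6) :
    {C : Set α | M.IsCircuit C ∧ C.ncard = 4 ∧ C ⊆ S}.ncard ≤ 126 := by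
  haveI : (M.restrict S).Finite := Matroid.restrict_finite (M.ground_finite.subset hS)
  have heq : {C : Set α | M.IsCircuit C ∧ C.ncard = 4 ∧ C ⊆ S} =
      {C : Set α | (M.restrict S).IsCircuit C ∧ C.ncard = 4} := by
    ext C
    simp only [Set.mem_setOf_eq, Matroid.restrict_isCircuit_iff hS]
    tauto
  rw [heq]
  obtain ⟨ν, hν6, hν'⟩ := PercRepro.Matroid.exists_nullity_eq_of_le (M.restrict S) (n := 6)
    (PercRepro.Matroid.dual_eRank_restrict_le hS hν)
  obtain ⟨c, hc, h⟩ := PercRepro.Matroid.exists_ncard_isCircuit_mul_choose_le (M.restrict S) hν' 4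
  rw [Matroid.restrict_ground_eq] at hc
  have hc' : c ≤ 12 := hc.trans hS12
  generalize {C : Set α | (M.restrict S).IsCircuit C ∧ C.ncard = 4}.ncard = s at h ⊢
  interval_cases ν <;> interval_cases c <;>
    norm_num [Nat.choose_eq_factorial_div_factorial, Nat.factorial, Nat.choose_two_right,
      Nat.choose_eq_zero_of_lt] at h ⊢ <;> omega

/-- **The planes with `≥ 6` points lie in the closure of the union of any two of them**, which has `≤ 12` points and
nullity `≤ 6` — on the coloop-free core with `|E| = 16`, `r(E) = 9`. -/
theorem big_planes_subset_closure_seven [M.Finite] (hs : ∀ e ∈ M.E, ∀ f ∈ M.E, e ≠ f → M.eRk {e, f} = 2)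
    (hC1 : ∀ L ⊆ M.E, M.eRk L = 2 → L.ncard ≤ 3) (hcoloop : ∀ e, ¬ M.IsColoop e)
    (hd : M.E.encard = M.eRank + 7) (hrank : M.eRank = ((9 : ℕ) : ℕ∞)) (hE : M.E.ncard = 16)
    {P Q : Set α} (hPE : P ⊆ M.E) (hQE : Q ⊆ M.E) (hPr : M.eRk P = 3) (hQr : M.eRk Q = 3)
    (hPcl : M.closure P = P) (hQcl : M.closure Q = Q) (hP6 : 6 ≤ P.ncard) (hQ6 : 6 ≤ Q.ncard) (hne : P ≠ Q) :
    (M.closure (P ∪ Q)).ncard ≤ 12 ∧ (M.closure (P ∪ Q)).encard ≤ M.eRk (M.closure (P ∪ Q)) + 6 ∧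
      ∀ R : Set α, R ⊆ M.E → M.eRk R = 3 → M.closure R = R → 6 ≤ R.ncard → R ⊆ M.closure (P ∪ Q) := by
  have hEfin : M.E.Finite := M.ground_finite
  have hPfin : P.Finite := hEfin.subset hPE
  have hQfin : Q.Finite := hEfin.subset hQE
  have hWfin : (P ∪ Q).Finite := hPfin.union hQfin
  have hWE : P ∪ Q ⊆ M.E := Set.union_subset hPE hQE
  have hE2 : 2 ≤ M.E.ncard := by omega
  set F := M.closure (P ∪ Q) with hFdef
  have hFE : F ⊆ M.E := M.closure_subset_ground _
  have hFfin : F.Finite := hEfin.subset hFE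
  have hWF : P ∪ Q ⊆ F := M.subset_closure _ hWE
  have hrF : M.eRk F = M.eRk (P ∪ Q) := M.eRk_closure_eq _
  obtain ⟨rI, hrI⟩ := exists_eRk_eq_nat (M := M) (P ∩ Q)
  obtain ⟨rW, hrW⟩ := exists_eRk_eq_nat (M := M) (P ∪ Q)
  obtain ⟨hrI2, hnI⟩ := big_planes_inter hs hC1 hPE hPr hQr hPcl hQcl hne
  -- `ν(W) ≥ 5`, `r(W) ≤ 6`
  have hsubm := M.eRk_inter_add_eRk_union_le P Q
  rw [hPr, hQr, hrI, hrW] at hsubm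
  have e1 : rI + rW ≤ 3 + 3 := by exact_mod_cast hsubm
  have hIE := Set.ncard_inter_add_ncard_union P Q hPfin hQfin
  have hν1 : (P ∩ Q).ncard ≤ rI + 1 := by
    have h := ncard_le_eRk_add_one_of_le_three hs (Set.inter_subset_left.trans hPE) hnI
    rw [hrI] at h; exact_mod_cast h
  have hWν : rW + 5 ≤ (P ∪ Q).ncard := by omega
  -- `ν(F) ≤ 6`
  have hF6 : F.ncard ≤ rW + 6 := by
    have hmono := encard_le_eRk_add_of_ground hFE hd
    rw [← hFfin.cast_ncard_eq, hrF, hrW] at hmono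
    have h1 : F.ncard ≤ rW + 7 := by exact_mod_cast hmono
    by_contra hlt
    push Not at hlt
    have hfull : F.encard = M.eRk F + 7 := by
      rw [← hFfin.cast_ncard_eq, hrF, hrW]
      have : F.ncard = rW + 7 := by omega
      rw [this]; push_cast; rfl
    have hFE' := eq_ground_of_encard_eq_eRk_add hcoloop hFE hd hfull
    have hrE : M.eRank = (rW : ℕ∞) := by rw [← M.eRk_ground, ← hFE', hrF, hrW]
    rw [hrank] at hrE
    have : (9 : ℕ) = rW := by exact_mod_cast hrE
    omega
  have hF12 : F.ncard ≤ 12 := by omega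
  have hFν : F.encard ≤ M.eRk F + 6 := by
    rw [← hFfin.cast_ncard_eq, hrF, hrW]
    exact_mod_cast hF6
  refine ⟨hF12, hFν, ?_⟩
  intro R hRE hRr hRcl hR6
  have hRfin : R.Finite := hEfin.subset hRE
  set Z := R ∩ (P ∪ Q) with hZdef
  have hZfin : Z.Finite := hRfin.subset Set.inter_subset_left
  have hZ4 : 4 ≤ Z.ncard := by
    by_contra h
    push Not at h
    obtain ⟨rZ, hrZ⟩ := exists_eRk_eq_nat (M := M) Z
    obtain ⟨rT, hrT⟩ := exists_eRk_eq_nat (M := M) ((P ∪ Q) ∪ R)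
    have hν := ncard_le_eRk_add_one_of_le_three hs (W := Z) (Set.inter_subset_left.trans hRE) (by omega)
    rw [hrZ] at hν
    have f1 : Z.ncard ≤ rZ + 1 := by exact_mod_cast hν
    have hsub := M.eRk_inter_add_eRk_union_le (P ∪ Q) R
    rw [Set.inter_comm, ← hZdef, hrZ, hrW, hRr, hrT] at hsub
    have f2 : rZ + rT ≤ rW + 3 := by exact_mod_cast hsub
    have hIE' := Set.ncard_inter_add_ncard_union (P ∪ Q) R hWfin hRfin
    rw [Set.inter_comm, ← hZdef] at hIE'
    have hTfin : ((P ∪ Q) ∪ R).Finite := hWfin.union hRfin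
    have hmono := encard_le_eRk_add_of_ground (Set.union_subset hWE hRE) hd
    rw [← hTfin.cast_ncard_eq, hrT] at hmono
    have f3 : ((P ∪ Q) ∪ R).ncard ≤ rT + 7 := by exact_mod_cast hmono
    -- the union has full nullity: it is `E`
    have hfull : ((P ∪ Q) ∪ R).encard = M.eRk ((P ∪ Q) ∪ R) + 7 := by
      rw [← hTfin.cast_ncard_eq, hrT]
      have : ((P ∪ Q) ∪ R).ncard = rT + 7 := by omega
      rw [this]; push_cast; rfl
    have hTE := eq_ground_of_encard_eq_eRk_add hcoloop (Set.union_subset hWE hRE) hd hfull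
    have hrE : M.eRank = (rT : ℕ∞) := by rw [← M.eRk_ground, ← hTE, hrT]
    rw [hrank] at hrE
    have f4 : (9 : ℕ) = rT := by exact_mod_cast hrE
    -- so `r(Z) = 0`, `Z = ∅`, and `|E| = |W| + |R| ≥ 11 + 6`
    have f5 : Z.ncard ≤ rZ := by
      have h0 := ncard_le_eRk_of_le_two hs hE2 (W := Z) (Set.inter_subset_left.trans hRE) (by omega)
      rw [hrZ] at h0; exact_mod_cast h0
    have f6 : ((P ∪ Q) ∪ R).ncard = 16 := by rw [hTE, hE]
    omega
  have hZR : Z ⊆ R := Set.inter_subset_left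
  have hZr : 3 ≤ M.eRk Z := three_le_eRk_of_four_le_ncard hs hC1 (hZR.trans hRE) hZ4
  have hle : M.eRk R ≤ M.eRk Z := by rw [hRr]; exact hZr
  have h1 := (M.isRkFinite_of_finite hZfin).closure_eq_closure_of_subset_of_eRk_ge_eRk hZR hle
  rw [hRcl] at h1
  rw [← h1]
  exact M.closure_subset_closure Set.inter_subset_right

/-- **`7·#{sets of rank ≤ 3 with ≥ 5 points} ≤ 7·s₄ + 22·126`** on the coloop-free core with `|E| = 16`, `r(E) = 9`:
the planes with `≤ 5` points contribute at most one set each (and carry a `4`-circuit each), the planes with `≥ 6` points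
contribute at most `29/7` sets per `4`-circuit of their own (`CorePlanes`), and those `4`-circuits all lie in
`cl(P₁ ∪ P₂)` for two of the big planes — or in the single big plane — a set of `≤ 12` points and nullity `≤ 6` with
`≤ 126` four-circuits. -/
theorem seven_mul_ncard_big_sets_le_seven [M.Finite] (hs : ∀ e ∈ M.E, ∀ f ∈ M.E, e ≠ f → M.eRk {e, f} = 2)
    (hC1 : ∀ L ⊆ M.E, M.eRk L = 2 → L.ncard ≤ 3) (hC2 : ∀ P ⊆ M.E, M.eRk P = 3 → P.ncard ≤ 7)
    (hcoloop : ∀ e, ¬ M.IsColoop e) (hd : M.E.encard = M.eRank + 7) (hrank : M.eRank = ((9 : ℕ) : ℕ∞))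
    (hE : M.E.ncard = 16) :
    7 * {X : Set α | X ⊆ M.E ∧ M.eRk X ≤ 3 ∧ 5 ≤ X.ncard}.ncard ≤
      7 * (PercRepro.Matroid.circuitsEq M 4).ncard + 2772 := by
  classical
  have h4fin : (PercRepro.Matroid.circuitsEq M 4).Finite := PercRepro.Matroid.circuitsEq_finite 4
  set F₄ := h4fin.toFinset with hF₄
  set Pl := F₄.image (fun C => M.closure C) with hPldef
  have hEsub : {X : Set α | X ⊆ M.E}.Finite := M.ground_finite.finite_subsets
  let g : Set α → Finset (Set α) := fun P => hEsub.toFinset.filter (fun X => X ⊆ P ∧ 5 ≤ X.ncard)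
  have hcirc_rank : ∀ C, M.IsCircuit C → C.ncard = 4 → M.eRk C = 3 := by
    intro C hC hC4
    have hCfin : C.Finite := M.ground_finite.subset hC.subset_ground
    have h := hC.eRk_add_one_eq
    rw [← hCfin.cast_ncard_eq, hC4] at h
    obtain ⟨r, hr⟩ := exists_eRk_eq_nat (M := M) C
    rw [hr] at h ⊢
    have : r + 1 = 4 := by exact_mod_cast h
    have : r = 3 := by omega
    rw [this]; rfl
  have hPl : ∀ P ∈ Pl, P ⊆ M.E ∧ M.eRk P = 3 ∧ M.closure P = P ∧ 4 ≤ P.ncard ∧ P.ncard ≤ 7 := by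
    intro P hP
    rw [hPldef, Finset.mem_image] at hP
    obtain ⟨C, hC, rfl⟩ := hP
    rw [hF₄, Set.Finite.mem_toFinset] at hC
    have hclr : M.eRk (M.closure C) = 3 := by rw [M.eRk_closure_eq]; exact hcirc_rank C hC.1 hC.2
    have hCcl : C ⊆ M.closure C := M.subset_closure C hC.1.subset_ground
    have hclfin : (M.closure C).Finite := M.ground_finite.subset (M.closure_subset_ground C)
    refine ⟨M.closure_subset_ground C, hclr, M.closure_closure C, ?_,
      hC2 _ (M.closure_subset_ground C) hclr⟩
    rw [← hC.2]
    exact Set.ncard_le_ncard hCcl hclfin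
  have hcover : {X : Set α | X ⊆ M.E ∧ M.eRk X ≤ 3 ∧ 5 ≤ X.ncard} ⊆ ↑(Pl.biUnion g) := by
    rintro X ⟨hXE, hXr, hX5⟩
    obtain ⟨Y, hYX, hY5⟩ := Set.exists_subset_card_eq hX5
    have hYE : Y ⊆ M.E := hYX.trans hXE
    obtain ⟨C, hCY, hC, hC4⟩ := exists_isCircuit_four_of_five hs hC1 hYE hY5 ((M.eRk_mono hYX).trans hXr)
    have hCX : C ⊆ X := hCY.trans hYX
    have hCfin : C.Finite := M.ground_finite.subset hC.subset_ground
    have hCr : M.eRk C = 3 := hcirc_rank C hC hC4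
    have hcl : M.closure C = M.closure X :=
      (M.isRkFinite_of_finite hCfin).closure_eq_closure_of_subset_of_eRk_ge_eRk hCX (by rw [hCr]; exact hXr)
    have hXcl : X ⊆ M.closure C := by rw [hcl]; exact M.subset_closure X hXE
    rw [Finset.mem_coe, Finset.mem_biUnion]
    refine ⟨M.closure C, ?_, ?_⟩
    · rw [hPldef, Finset.mem_image]
      exact ⟨C, by rw [hF₄, Set.Finite.mem_toFinset]; exact ⟨hC, hC4⟩, rfl⟩
    · simp only [g, Finset.mem_filter, Set.Finite.mem_toFinset, Set.mem_setOf_eq]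
      exact ⟨hXE, hXcl, hX5⟩
  -- per plane: `7·(g P).card ≤ 29·c(P)`, and `(g P).card ≤ c(P)` for a plane with `≤ 5` points
  have hg : ∀ P ∈ Pl, (g P).card ≤ {X : Set α | X ⊆ P ∧ 5 ≤ X.ncard}.ncard := by
    intro P hP
    have hPE := (hPl P hP).1
    have hfinS : {X : Set α | X ⊆ P ∧ 5 ≤ X.ncard}.Finite := hEsub.subset (fun X hX => hX.1.trans hPE)
    have hsub : (↑(g P) : Set (Set α)) ⊆ {X : Set α | X ⊆ P ∧ 5 ≤ X.ncard} := by
      intro X hX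
      simp only [g, Finset.coe_filter, Set.Finite.mem_toFinset, Set.mem_setOf_eq] at hX
      exact ⟨hX.2.1, hX.2.2⟩
    have := Set.ncard_le_ncard hsub hfinS
    rwa [Set.ncard_coe_finset] at this
  let c : Set α → ℕ := fun P => (F₄.filter (fun C => M.closure C = P)).card
  have hc1 : ∀ P ∈ Pl, 1 ≤ c P := by
    intro P hP
    rw [hPldef, Finset.mem_image] at hP
    obtain ⟨C, hC, rfl⟩ := hP
    exact Finset.card_pos.2 ⟨C, Finset.mem_filter.2 ⟨hC, rfl⟩⟩
  have hper : ∀ P ∈ Pl, 7 * (g P).card ≤ 29 * c P := by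
    intro P hP
    obtain ⟨hPE, hPr, hPcl, hP4, hP7⟩ := hPl P hP
    have hPfin : P.Finite := M.ground_finite.subset hPE
    have hg' : (g P).card ≤ P.ncard.choose 5 + P.ncard.choose 6 + P.ncard.choose 7 :=
      (hg P hP).trans (ncard_subsets_five_le_le_choose hPfin hP7)
    have hc := choose_five_le_mul_card_circuits_closure_eq hs hC1 hPE hPr hPcl
    rw [← hF₄] at hc
    show 7 * (g P).card ≤ 29 * (F₄.filter (fun C => M.closure C = P)).card
    generalize hk : P.ncard = k at hg' hc hP4 hP7
    generalize (F₄.filter (fun C => M.closure C = P)).card = cc at hc ⊢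
    generalize (g P).card = a at hg' ⊢
    interval_cases k <;>
      norm_num [Nat.choose_eq_factorial_div_factorial, Nat.factorial, Nat.choose_eq_zero_of_lt] at hg' hc ⊢ <;>
      omega
  have hsmall : ∀ P ∈ Pl, P.ncard ≤ 5 → (g P).card ≤ c P := by
    intro P hP h5
    exact ((hg P hP).trans (ncard_subsets_five_le_le_one (M.ground_finite.subset (hPl P hP).1) h5)).trans
      (hc1 P hP)
  -- the big planes and the `4`-circuits with a big closure
  set big := Pl.filter (fun Q => 6 ≤ Q.ncard) with hbigdef
  set small := Pl.filter (fun Q => ¬ 6 ≤ Q.ncard) with hsmalldef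
  have hsplit : (∑ P ∈ big, (g P).card) + ∑ P ∈ small, (g P).card = ∑ P ∈ Pl, (g P).card := by
    rw [hbigdef, hsmalldef]
    exact Finset.sum_filter_add_sum_filter_not Pl (fun Q => 6 ≤ Q.ncard) (fun P => (g P).card)
  have hsum : F₄.card = ∑ P ∈ Pl, c P := Finset.card_eq_sum_card_image (fun C => M.closure C) F₄
  have hsumsplit : (∑ P ∈ big, c P) + ∑ P ∈ small, c P = ∑ P ∈ Pl, c P := by
    rw [hbigdef, hsmalldef]
    exact Finset.sum_filter_add_sum_filter_not Pl (fun Q => 6 ≤ Q.ncard) c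
  -- `b := Σ_{big} c P ≤ 126`
  have hb : ∑ P ∈ big, c P ≤ 126 := by
    -- the `4`-circuits with a big closure lie in one bounded set `S`
    have hkey : ∃ S : Set α, S ⊆ M.E ∧ S.ncard ≤ 12 ∧ S.encard ≤ M.eRk S + 6 ∧
        ∀ P ∈ big, ∀ C ∈ F₄, M.closure C = P → C ⊆ S := by
      rcases Nat.lt_or_ge big.card 2 with hlt | hge
      · -- at most one big plane: `S` = that plane (or `∅`)
        rcases Nat.lt_or_ge big.card 1 with h0 | h1
        · refine ⟨∅, Set.empty_subset _, by simp, by simp, ?_⟩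
          intro P hP
          have : big.card = 0 := by omega
          rw [Finset.card_eq_zero] at this
          rw [this] at hP
          exact absurd hP (Finset.notMem_empty P)
        · have hcard1 : big.card = 1 := by omega
          obtain ⟨P₀, hP₀⟩ := Finset.card_eq_one.1 hcard1
          have hP₀mem : P₀ ∈ big := by rw [hP₀]; exact Finset.mem_singleton_self P₀
          rw [hbigdef, Finset.mem_filter] at hP₀mem
          obtain ⟨hP₀E, hP₀r, _, _, hP₀7⟩ := hPl P₀ hP₀mem.1
          have hP₀fin : P₀.Finite := M.ground_finite.subset hP₀E
          refine ⟨P₀, hP₀E, by omega, ?_, ?_⟩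
          · rw [← hP₀fin.cast_ncard_eq, hP₀r]
            exact_mod_cast (show P₀.ncard ≤ 3 + 6 by omega)
          · intro P hP C hC hCP
            rw [hP₀, Finset.mem_singleton] at hP
            rw [hP] at hCP
            rw [← hCP]
            rw [hF₄, Set.Finite.mem_toFinset] at hC
            exact M.subset_closure C hC.1.subset_ground
      · -- two big planes `P₁ ≠ P₂`: `S = cl(P₁ ∪ P₂)`
        obtain ⟨P₁, hP₁, P₂, hP₂, hne⟩ := Finset.one_lt_card.1 (by omega : 1 < big.card)
        rw [hbigdef, Finset.mem_filter] at hP₁ hP₂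
        obtain ⟨hP₁E, hP₁r, hP₁cl, _, _⟩ := hPl P₁ hP₁.1
        obtain ⟨hP₂E, hP₂r, hP₂cl, _, _⟩ := hPl P₂ hP₂.1
        obtain ⟨hF12, hFν, hFall⟩ := big_planes_subset_closure_seven hs hC1 hcoloop hd hrank hE hP₁E hP₂E
          hP₁r hP₂r hP₁cl hP₂cl hP₁.2 hP₂.2 hne
        refine ⟨M.closure (P₁ ∪ P₂), M.closure_subset_ground _, hF12, hFν, ?_⟩
        intro P hP C hC hCP
        rw [hbigdef, Finset.mem_filter] at hP
        obtain ⟨hPE, hPr, hPcl, _, _⟩ := hPl P hP.1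
        have hRF := hFall P hPE hPr hPcl hP.2
        rw [hF₄, Set.Finite.mem_toFinset] at hC
        exact (M.subset_closure C hC.1.subset_ground).trans (hCP ▸ hRF)
    obtain ⟨S, hSE, hS12, hSν, hSall⟩ := hkey
    -- `Σ_{big} c P = #{C ∈ F₄ : cl C ∈ big} ≤ #{4-circuits ⊆ S}`
    have hfib : ∑ P ∈ big, c P = (F₄.filter (fun C => M.closure C ∈ big)).card := by
      rw [Finset.card_eq_sum_card_fiberwise (f := fun C => M.closure C) (t := big)
        (fun C hC => by simpa using (Finset.mem_filter.1 hC).2)]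
      apply Finset.sum_congr rfl
      intro P hP
      show (F₄.filter (fun C => M.closure C = P)).card =
        ((F₄.filter (fun C => M.closure C ∈ big)).filter (fun C => M.closure C = P)).card
      rw [Finset.filter_filter]
      congr 1
      apply Finset.filter_congr
      intro C _
      constructor
      · intro h; exact ⟨h ▸ hP, h⟩
      · intro h; exact h.2
    rw [hfib]
    have hsub : (↑(F₄.filter (fun C => M.closure C ∈ big)) : Set (Set α)) ⊆
        {C : Set α | M.IsCircuit C ∧ C.ncard = 4 ∧ C ⊆ S} := by
      intro C hC
      rw [Finset.mem_coe, Finset.mem_filter] at hC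
      have hC' := hC.1
      rw [hF₄, Set.Finite.mem_toFinset] at hC'
      exact ⟨hC'.1, hC'.2, hSall _ hC.2 C hC.1 rfl⟩
    have hfinS : {C : Set α | M.IsCircuit C ∧ C.ncard = 4 ∧ C ⊆ S}.Finite :=
      M.ground_finite.finite_subsets.subset (fun C hC => hC.1.subset_ground)
    have := Set.ncard_le_ncard hsub hfinS
    rw [Set.ncard_coe_finset] at this
    exact this.trans (ncard_circuits_four_subset_le hSE hS12 hSν)
  -- assemble: `7·Σ_{Pl} g ≤ 29·Σ_{big} c + 7·Σ_{small} c = 7·Σ_{Pl} c + 22·Σ_{big} c`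
  have hA : 7 * ∑ P ∈ big, (g P).card ≤ 29 * ∑ P ∈ big, c P := by
    rw [Finset.mul_sum, Finset.mul_sum]
    exact Finset.sum_le_sum (fun P hP => hper P (Finset.mem_filter.1 hP).1)
  have hB : ∑ P ∈ small, (g P).card ≤ ∑ P ∈ small, c P :=
    Finset.sum_le_sum (fun P hP => hsmall P (Finset.mem_filter.1 hP).1 (by
      have := (Finset.mem_filter.1 hP).2; omega))
  have hs₄ : (PercRepro.Matroid.circuitsEq M 4).ncard = F₄.card := by
    rw [hF₄, ← Set.ncard_eq_toFinset_card _ h4fin]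
  calc 7 * {X : Set α | X ⊆ M.E ∧ M.eRk X ≤ 3 ∧ 5 ≤ X.ncard}.ncard
      ≤ 7 * (↑(Pl.biUnion g) : Set (Set α)).ncard :=
        Nat.mul_le_mul_left _ (Set.ncard_le_ncard hcover (Finset.finite_toSet _))
    _ = 7 * (Pl.biUnion g).card := by rw [Set.ncard_coe_finset]
    _ ≤ 7 * ∑ P ∈ Pl, (g P).card := Nat.mul_le_mul_left _ Finset.card_biUnion_le
    _ = 7 * ((∑ P ∈ big, (g P).card) + ∑ P ∈ small, (g P).card) := by rw [hsplit]
    _ ≤ 29 * (∑ P ∈ big, c P) + 7 * ∑ P ∈ small, c P := by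
        have := Nat.mul_le_mul_left 7 hB
        omega
    _ = 7 * ((∑ P ∈ big, c P) + ∑ P ∈ small, c P) + 22 * ∑ P ∈ big, c P := by ring
    _ = 7 * F₄.card + 22 * ∑ P ∈ big, c P := by rw [hsumsplit, ← hsum]
    _ ≤ 7 * F₄.card + 22 * 126 := by
        have := Nat.mul_le_mul_left 22 hb
        omega
    _ = 7 * (PercRepro.Matroid.circuitsEq M 4).ncard + 2772 := by rw [hs₄]

end CoreFour
end PercRepro
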